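import Literature.NumberTheory.Automorphic.ParabolicIndGLDetCharIrreducible
import Literature.NumberTheory.Automorphic.OpenBruhatCellGL
import Literature.LinearAlgebra.Matrix.DiagonalTorusGL
import HarnessLib

/-!
# The open-cell radical `N'` of the maximal parabolic `Q_{N-1,1}` and its conjugation by `d(t) = diag(1, …, 1, t)`

Topic `NumberTheory/Automorphic/Zelevinsky1980`; theorems only (no definition, no named fact). For the
block labelling `lastBlockLabel N` of `ParabolicIndGLDetCharIrreducible` (`Q_{N-1,1} ≤ GL_N`, the last
index labelled `true`), the group `N' = oppositeCellRadical (lastBlockLabel N)` of `OpenBruhatCellGL`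
(the radical of the reversed parabolic `Q_{1,N-1}`, parametrising the open `(Q_{N-1,1}, U_N)`-cell
`Q_{N-1,1} w₀ N'`) is the abelian group of matrices `1 + e_0 yᵀ`, `y_0 = 0`:

* `mem_oppositeCellRadical_lastBlockLabel_iff`, `mul_apply_zero_of_mem_oppositeCellRadical`
  (`(xy)_{0j} = x_{0j} + y_{0j}`), `mul_comm_of_mem_oppositeCellRadical`, the elementary matrices
  `1 + β E_{0,last} ∈ N' ∩ U_c` (`exists_transvection_mem`);
* the diagonal elements `d(t) = diag(1, …, 1, t)`, `d₀(t) = diag(t, 1, …, 1) = w₀ d(t) w₀⁻¹`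
  (`permGL_rev_mul_diag_mul_inv`; `diagGL` of `DiagonalTorusGL`), the first-row entries of
  `d(t)^{∓1} x d(t)^{±1}` (the last coordinate is scaled by `t^{±1}`), and **the commutator trick**
  `diag_conj_mul_mem_unipotentRadicalGL`: `d(t) r⁻¹ d(t)⁻¹ · e · r ∈ U_c` for `r ∈ N'` and
  `e = 1 + β E_{0,last}` — the reason why the `U_c`-coinvariants of the open-cell part of
  `Ind_{Q_{N-1,1}}^{GL_N}` see `d(t)` act through a scalar (`JacquetOfInducedMaximalParabolic`).

Elementary matrix algebra (Bernstein–Zelevinsky 1977, §6, the open orbit of the geometric lemma for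
the pair `(Q_{N-1,1}, Q_{N-1,1})`).

## References

* I. N. Bernstein, A. V. Zelevinsky, *Induced representations of reductive `p`-adic groups I*,
  Ann. Sci. ÉNS 10 (1977), Thm. 5.2, §6. [BernsteinZelevinskyASENS1977]
* A. V. Zelevinsky, *Induced representations of reductive `p`-adic groups II*, Ann. Sci. ÉNS 13
  (1980), §1.1, §3.2. [Zelevinsky1980]
-/

noncomputable section

open Matrix Literature.LinearAlgebra.Matrix.DiagonalTorus

namespace Literature.NumberTheory.Automorphic.Zelevinsky1980

variable {F : Type*} [Field F]

/-- `lastBlockLabel N` is monotone (`false < true`, and the label is `true` exactly at the last index). [cite: BernsteinZelevinskyASENS1977, §6.3 and §7.1] -/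
theorem monotone_lastBlockLabel (N : ℕ) : Monotone (lastBlockLabel N) := by
  intro i j hij
  simp only [lastBlockLabel]
  rcases Bool.eq_false_or_eq_true (decide (N ≤ (i : ℕ) + 1)) with h | h
  · rw [h]
    have : N ≤ (j : ℕ) + 1 := (decide_eq_true_iff.mp h).trans (by
      have := hij; simp only [Fin.le_def] at this; omega)
    rw [decide_eq_true this]
  · rw [h]
    exact Bool.false_le _

/-- The reversed labelling of `lastBlockLabel N` labels exactly the index `0` by `true`. [cite: BernsteinZelevinskyASENS1977, §6.3 and §7.1] -/
theorem revLabel_lastBlockLabel_apply {N : ℕ} (i : Fin N) :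
    revLabel (lastBlockLabel N) i = decide ((i : ℕ) = 0) := by
  simp only [revLabel_apply, lastBlockLabel, Fin.val_rev]
  by_cases h : (i : ℕ) = 0
  · rw [decide_eq_true h, decide_eq_true (by omega)]
  · rw [decide_eq_false h, decide_eq_false (by omega)]

/-- Membership in `N' = oppositeCellRadical (lastBlockLabel N)`: the matrices `1 + e_0 yᵀ` with
`y_0 = 0`, i.e. `g i j = δ_{ij}` unless `i = 0` and `j ≠ 0`. [cite: BernsteinZelevinskyASENS1977, §6.3 and §7.1] -/
theorem mem_oppositeCellRadical_lastBlockLabel_iff {N : ℕ} (g : GL (Fin N) F) :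
    g ∈ oppositeCellRadical (K := F) (lastBlockLabel N) ↔
      ∀ i j : Fin N, ¬ ((i : ℕ) = 0 ∧ (j : ℕ) ≠ 0) →
        (g : Matrix (Fin N) (Fin N) F) i j = (1 : Matrix (Fin N) (Fin N) F) i j := by
  rw [oppositeCellRadical, mem_unipotentRadicalGL_iff_apply]
  refine forall_congr' fun i => forall_congr' fun j => ?_
  have key : ((⇑OrderDual.toDual ∘ revLabel (lastBlockLabel N)) j ≤
      (⇑OrderDual.toDual ∘ revLabel (lastBlockLabel N)) i) ↔ ¬ ((i : ℕ) = 0 ∧ (j : ℕ) ≠ 0) := by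
    simp only [Function.comp_apply, OrderDual.toDual_le_toDual, revLabel_lastBlockLabel_apply]
    by_cases hi : (i : ℕ) = 0 <;> by_cases hj : (j : ℕ) = 0 <;> simp [hi, hj]
  rw [key]

/-! ### The abelian group `N'`: first-row coordinates -/

/-- Off the first row an element of `N'` agrees with the identity. [cite: BernsteinZelevinskyASENS1977, §6.3 and §7.1] -/
theorem apply_eq_one_of_mem_oppositeCellRadical {N : ℕ} {g : GL (Fin N) F}
    (hg : g ∈ oppositeCellRadical (K := F) (lastBlockLabel N)) {i : Fin N} (hi : (i : ℕ) ≠ 0) (j : Fin N) :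
    (g : Matrix (Fin N) (Fin N) F) i j = (1 : Matrix (Fin N) (Fin N) F) i j :=
  (mem_oppositeCellRadical_lastBlockLabel_iff g).1 hg i j fun h => hi h.1

/-- The `(0,0)` entry of an element of `N'` is `1`. [cite: BernsteinZelevinskyASENS1977, §6.3 and §7.1] -/
theorem apply_zero_zero_of_mem_oppositeCellRadical {n : ℕ} {g : GL (Fin (n + 1)) F}
    (hg : g ∈ oppositeCellRadical (K := F) (lastBlockLabel (n + 1))) :
    (g : Matrix (Fin (n + 1)) (Fin (n + 1)) F) 0 0 = 1 := by
  rw [(mem_oppositeCellRadical_lastBlockLabel_iff g).1 hg 0 0 fun h => h.2 rfl, Matrix.one_apply_eq]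

/-- **`N'` is the additive group of its first rows**: `(x y)_{0j} = x_{0j} + y_{0j}` for `j ≠ 0`. [cite: BernsteinZelevinskyASENS1977, §6.3 and §7.1] -/
theorem mul_apply_zero_of_mem_oppositeCellRadical {n : ℕ} {x y : GL (Fin (n + 1)) F}
    (hx : x ∈ oppositeCellRadical (K := F) (lastBlockLabel (n + 1)))
    (hy : y ∈ oppositeCellRadical (K := F) (lastBlockLabel (n + 1))) {j : Fin (n + 1)} (hj : j ≠ 0) :
    ((x * y : GL (Fin (n + 1)) F) : Matrix (Fin (n + 1)) (Fin (n + 1)) F) 0 j =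
      (x : Matrix (Fin (n + 1)) (Fin (n + 1)) F) 0 j + (y : Matrix (Fin (n + 1)) (Fin (n + 1)) F) 0 j := by
  rw [Units.val_mul, Matrix.mul_apply, ← Finset.add_sum_erase _ _ (Finset.mem_univ (0 : Fin (n + 1))),
    apply_zero_zero_of_mem_oppositeCellRadical hx, one_mul, add_comm, Finset.sum_eq_single j]
  · have hj0 : (j : ℕ) ≠ 0 := fun h => hj (Fin.ext h)
    rw [apply_eq_one_of_mem_oppositeCellRadical hy hj0, Matrix.one_apply_eq, mul_one, add_comm]
  · intro k hk hkj
    have hk0 : (k : ℕ) ≠ 0 := fun h => (Finset.mem_erase.1 hk).1 (Fin.ext h)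
    rw [apply_eq_one_of_mem_oppositeCellRadical hy hk0, Matrix.one_apply_ne hkj, mul_zero]
  · intro h
    exact absurd (Finset.mem_erase.2 ⟨hj, Finset.mem_univ j⟩) h

/-- Two elements of `N'` with the same first row are equal. [cite: BernsteinZelevinskyASENS1977, §6.3 and §7.1] -/
theorem eq_of_mem_oppositeCellRadical_of_apply_zero_eq {n : ℕ} {x y : GL (Fin (n + 1)) F}
    (hx : x ∈ oppositeCellRadical (K := F) (lastBlockLabel (n + 1)))
    (hy : y ∈ oppositeCellRadical (K := F) (lastBlockLabel (n + 1)))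
    (h : ∀ j : Fin (n + 1), j ≠ 0 →
      (x : Matrix (Fin (n + 1)) (Fin (n + 1)) F) 0 j = (y : Matrix (Fin (n + 1)) (Fin (n + 1)) F) 0 j) :
    x = y := by
  apply Units.ext
  ext i j
  by_cases hi : (i : ℕ) = 0
  · have hi' : i = 0 := Fin.ext hi
    subst hi'
    by_cases hj : j = 0
    · subst hj
      rw [apply_zero_zero_of_mem_oppositeCellRadical hx, apply_zero_zero_of_mem_oppositeCellRadical hy]
    · exact h j hj
  · rw [apply_eq_one_of_mem_oppositeCellRadical hx hi, apply_eq_one_of_mem_oppositeCellRadical hy hi]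

/-- **`N'` is commutative.** [cite: BernsteinZelevinskyASENS1977, §6.3 and §7.1] -/
theorem mul_comm_of_mem_oppositeCellRadical {n : ℕ} {x y : GL (Fin (n + 1)) F}
    (hx : x ∈ oppositeCellRadical (K := F) (lastBlockLabel (n + 1)))
    (hy : y ∈ oppositeCellRadical (K := F) (lastBlockLabel (n + 1))) : x * y = y * x :=
  eq_of_mem_oppositeCellRadical_of_apply_zero_eq (Subgroup.mul_mem _ hx hy) (Subgroup.mul_mem _ hy hx)
    fun j hj => by
      rw [mul_apply_zero_of_mem_oppositeCellRadical hx hy hj, mul_apply_zero_of_mem_oppositeCellRadical hy hx hj,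
        add_comm]

/-- First row of the inverse: `(x⁻¹)_{0j} = -x_{0j}` for `j ≠ 0`. [cite: BernsteinZelevinskyASENS1977, §6.3 and §7.1] -/
theorem inv_apply_zero_of_mem_oppositeCellRadical {n : ℕ} {x : GL (Fin (n + 1)) F}
    (hx : x ∈ oppositeCellRadical (K := F) (lastBlockLabel (n + 1))) {j : Fin (n + 1)} (hj : j ≠ 0) :
    ((x⁻¹ : GL (Fin (n + 1)) F) : Matrix (Fin (n + 1)) (Fin (n + 1)) F) 0 j =
      -(x : Matrix (Fin (n + 1)) (Fin (n + 1)) F) 0 j := by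
  have h := mul_apply_zero_of_mem_oppositeCellRadical (Subgroup.inv_mem _ hx) hx hj
  rw [inv_mul_cancel, Units.val_one, Matrix.one_apply_ne (Ne.symm hj)] at h
  exact eq_neg_of_add_eq_zero_left h.symm

/-- The elementary matrix `1 + β E_{0,last}` lies in `N'`, in the unipotent radical `U_c` of
`Q_{N-1,1}`, and has first row `(1, 0, …, 0, β)`. [cite: BernsteinZelevinskyASENS1977, §6.3 and §7.1] -/
theorem exists_transvection_mem {n : ℕ} (β : F) :
    ∃ e : GL (Fin (n + 2)) F, e ∈ oppositeCellRadical (K := F) (lastBlockLabel (n + 2)) ∧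
      e ∈ unipotentRadicalGL F (lastBlockLabel (n + 2)) ∧
      (e : Matrix (Fin (n + 2)) (Fin (n + 2)) F) = Matrix.transvection 0 (Fin.last (n + 1)) β := by
  have hne : (0 : Fin (n + 2)) ≠ Fin.last (n + 1) := by simp [Fin.ext_iff]
  let e : GL (Fin (n + 2)) F :=
    ⟨Matrix.transvection 0 (Fin.last (n + 1)) β, Matrix.transvection 0 (Fin.last (n + 1)) (-β),
      by rw [Matrix.transvection_mul_transvection_same _ _ hne, add_neg_cancel, Matrix.transvection_zero],
      by rw [Matrix.transvection_mul_transvection_same _ _ hne, neg_add_cancel, Matrix.transvection_zero]⟩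
  have hval : (e : Matrix (Fin (n + 2)) (Fin (n + 2)) F) = Matrix.transvection 0 (Fin.last (n + 1)) β := rfl
  have hentry : ∀ i j : Fin (n + 2), ¬ (i = 0 ∧ j = Fin.last (n + 1)) →
      (e : Matrix (Fin (n + 2)) (Fin (n + 2)) F) i j = (1 : Matrix (Fin (n + 2)) (Fin (n + 2)) F) i j := by
    intro i j hij
    rw [hval, Matrix.transvection, Matrix.add_apply, Matrix.single_apply_of_ne, add_zero]
    exact fun h => hij ⟨h.1.symm, h.2.symm⟩
  refine ⟨e, ?_, ?_, hval⟩
  · rw [mem_oppositeCellRadical_lastBlockLabel_iff]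
    intro i j hij
    refine hentry i j fun h => hij ⟨by simp [h.1], by simp [h.2]⟩
  · rw [mem_unipotentRadicalGL_iff_apply]
    intro i j hij
    refine hentry i j fun h => ?_
    rw [h.1, h.2] at hij
    simp [lastBlockLabel, Fin.last] at hij
    exact absurd hij (by decide)

/-! ### Diagonal elements -/

/-- A diagonal matrix lies in every standard parabolic. [cite: BernsteinZelevinskyASENS1977, §6.3 and §7.1] -/
theorem diagGL_mem_standardParabolicGL {m : Type*} [Fintype m] [DecidableEq m] {α : Type*} [LinearOrder α]
    (c : m → α) (u : m → Fˣ) : diagGL m u ∈ standardParabolicGL F c := by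
  rw [mem_standardParabolicGL_iff, val_diagGL]
  exact Matrix.blockTriangular_diagonal _

/-- Conjugating a diagonal matrix by the permutation matrix `P_σ` permutes the entries:
`P_σ diag(u) P_σ⁻¹ = diag(u ∘ σ)`. [cite: BernsteinZelevinskyASENS1977, §6.3 and §7.1] -/
theorem permGL_mul_diagGL_mul_inv {N : ℕ} (σ : Equiv.Perm (Fin N)) (u : Fin N → Fˣ) :
    permGL σ * diagGL (Fin N) u * (permGL σ)⁻¹ = diagGL (Fin N) (u ∘ σ) := by
  apply Units.ext
  rw [coe_permGL_mul_mul_inv, val_diagGL, val_diagGL]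
  ext a b
  simp only [Matrix.submatrix_apply, Matrix.diagonal_apply, Function.comp_apply,
    σ.injective.eq_iff]

/-- Conjugation of `n' ∈ N'` by a diagonal matrix stays in `N'`:
`(diag(u)⁻¹ n' diag(u))_{ij} = u_i⁻¹ n'_{ij} u_j`. [cite: BernsteinZelevinskyASENS1977, §6.3 and §7.1] -/
theorem diagGL_inv_mul_mul_mem_oppositeCellRadical {N : ℕ} (u : Fin N → Fˣ) {n' : GL (Fin N) F}
    (hn' : n' ∈ oppositeCellRadical (K := F) (lastBlockLabel N)) :
    (diagGL (Fin N) u)⁻¹ * n' * diagGL (Fin N) u ∈ oppositeCellRadical (K := F) (lastBlockLabel N) := by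
  rw [mem_oppositeCellRadical_lastBlockLabel_iff] at hn' ⊢
  intro i j hij
  rw [Units.val_mul, Units.val_mul, val_inv_diagGL, val_diagGL, Matrix.mul_diagonal,
    Matrix.diagonal_mul, hn' i j hij, Matrix.one_apply]
  by_cases h : i = j
  · subst h; simp
  · simp [h]

/-- Entries of `diag(u)⁻¹ n' diag(u)`. [cite: BernsteinZelevinskyASENS1977, §6.3 and §7.1] -/
theorem coe_diagGL_inv_mul_mul_apply {N : ℕ} (u : Fin N → Fˣ) (g : GL (Fin N) F) (i j : Fin N) :
    (((diagGL (Fin N) u)⁻¹ * g * diagGL (Fin N) u : GL (Fin N) F) : Matrix (Fin N) (Fin N) F) i j =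
      ((u i)⁻¹ : Fˣ) * (g : Matrix (Fin N) (Fin N) F) i j * (u j : F) := by
  rw [Units.val_mul, Units.val_mul, val_inv_diagGL, val_diagGL, Matrix.mul_diagonal,
    Matrix.diagonal_mul]

end Literature.NumberTheory.Automorphic.Zelevinsky1980

/-! ### Conjugation of `N'` by `d(t) = diag(1, …, 1, t)` -/

namespace Literature.NumberTheory.Automorphic.Zelevinsky1980

variable {F : Type*} [Field F] {n : ℕ}

/-- Entries of `d(t)⁻¹ x d(t)`: the last coordinate of the first row is multiplied by `t`. [cite: BernsteinZelevinskyASENS1977, §6.3 and §7.1] -/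
theorem diag_inv_mul_mul_apply_zero (t : Fˣ) (x : GL (Fin (n + 2)) F) (j : Fin (n + 2)) :
    (((diagGL (Fin (n + 2)) (Function.update 1 (Fin.last (n + 1)) t))⁻¹ * x * diagGL (Fin (n + 2)) (Function.update 1 (Fin.last (n + 1)) t) : GL (Fin (n + 2)) F) : Matrix (Fin (n + 2)) (Fin (n + 2)) F) 0 j =
      (x : Matrix (Fin (n + 2)) (Fin (n + 2)) F) 0 j * if j = Fin.last (n + 1) then (t : F) else 1 := by
  have h0last : (0 : Fin (n + 2)) ≠ Fin.last (n + 1) := by simp [Fin.ext_iff]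
  rw [coe_diagGL_inv_mul_mul_apply]
  simp only [Function.update_apply, if_neg h0last, Pi.one_apply, inv_one, Units.val_one, one_mul]
  split_ifs with hj
  · rfl
  · rw [Units.val_one]

/-- Entries of `d(t) x d(t)⁻¹`: the last coordinate of the first row is multiplied by `t⁻¹`. [cite: BernsteinZelevinskyASENS1977, §6.3 and §7.1] -/
theorem diag_mul_mul_inv_apply_zero (t : Fˣ) (x : GL (Fin (n + 2)) F) (j : Fin (n + 2)) :
    ((diagGL (Fin (n + 2)) (Function.update 1 (Fin.last (n + 1)) t) * x * (diagGL (Fin (n + 2)) (Function.update 1 (Fin.last (n + 1)) t))⁻¹ : GL (Fin (n + 2)) F) : Matrix (Fin (n + 2)) (Fin (n + 2)) F) 0 j =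
      (x : Matrix (Fin (n + 2)) (Fin (n + 2)) F) 0 j * if j = Fin.last (n + 1) then ((t⁻¹ : Fˣ) : F) else 1 := by
  have hinv' : (diagGL (Fin (n + 2)) (Function.update 1 (Fin.last (n + 1)) t⁻¹))⁻¹ =
      diagGL (Fin (n + 2)) (Function.update 1 (Fin.last (n + 1)) t) := by
    rw [← map_inv, ← Function.update_inv, inv_one, inv_inv]
  rw [← hinv', inv_inv, diag_inv_mul_mul_apply_zero]

/-- `d(t) x d(t)⁻¹ ∈ N'` for `x ∈ N'`. [cite: BernsteinZelevinskyASENS1977, §6.3 and §7.1] -/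
theorem diag_mul_mul_inv_mem_oppositeCellRadical (t : Fˣ) {x : GL (Fin (n + 2)) F} (hx : x ∈ oppositeCellRadical (K := F) (lastBlockLabel (n + 2))) :
    diagGL (Fin (n + 2)) (Function.update 1 (Fin.last (n + 1)) t) * x * (diagGL (Fin (n + 2)) (Function.update 1 (Fin.last (n + 1)) t))⁻¹ ∈ oppositeCellRadical (K := F) (lastBlockLabel (n + 2)) := by
  have := diagGL_inv_mul_mul_mem_oppositeCellRadical (Function.update 1 (Fin.last (n + 1)) t)⁻¹ hx
  rwa [map_inv, inv_inv] at this

/-- `w₀ d(t) w₀⁻¹ = d₀(t) = diag(t, 1, …, 1)`. [cite: BernsteinZelevinskyASENS1977, §6.3 and §7.1] -/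
theorem permGL_rev_mul_diag_mul_inv (t : Fˣ) :
    permGL Fin.revPerm * diagGL (Fin (n + 2)) (Function.update 1 (Fin.last (n + 1)) t) * (permGL Fin.revPerm)⁻¹ = diagGL (Fin (n + 2)) (Function.update 1 0 t) := by
  rw [permGL_mul_diagGL_mul_inv]
  congr 1
  funext i
  have hrev : (Fin.revPerm i = Fin.last (n + 1)) ↔ i = 0 := by
    rw [Fin.revPerm_apply, ← Fin.rev_zero, Fin.rev_inj]
  simp only [Function.comp_apply, Function.update_apply, Pi.one_apply, hrev]

/-- **The commutator trick**: for `r ∈ N'` and the elementary matrix `e = 1 + β E_{0,last}`, the element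
`d(t) r⁻¹ d(t)⁻¹ · e · r` lies in the unipotent radical `U_c` of `Q_{N-1,1}` (its first row is
`(1, 0, …, 0, *)`). [cite: BernsteinZelevinskyASENS1977, §6.3 and §7.1] -/
theorem diag_conj_mul_mem_unipotentRadicalGL (t : Fˣ) {r e : GL (Fin (n + 2)) F}
    (hr : r ∈ oppositeCellRadical (K := F) (lastBlockLabel (n + 2)))
    (he : e ∈ oppositeCellRadical (K := F) (lastBlockLabel (n + 2)))
    (he0 : ∀ j : Fin (n + 2), j ≠ 0 → j ≠ Fin.last (n + 1) → (e : Matrix (Fin (n + 2)) (Fin (n + 2)) F) 0 j = 0) :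
    diagGL (Fin (n + 2)) (Function.update 1 (Fin.last (n + 1)) t) * r⁻¹ * (diagGL (Fin (n + 2)) (Function.update 1 (Fin.last (n + 1)) t))⁻¹ * e * r ∈ unipotentRadicalGL F (lastBlockLabel (n + 2)) := by
  have h1 : diagGL (Fin (n + 2)) (Function.update 1 (Fin.last (n + 1)) t) * r⁻¹ * (diagGL (Fin (n + 2)) (Function.update 1 (Fin.last (n + 1)) t))⁻¹ ∈ oppositeCellRadical (K := F) (lastBlockLabel (n + 2)) :=
    diag_mul_mul_inv_mem_oppositeCellRadical t (Subgroup.inv_mem _ hr)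
  have h2 := Subgroup.mul_mem _ h1 he
  have h3 := Subgroup.mul_mem _ h2 hr
  rw [mem_unipotentRadicalGL_iff_apply]
  intro i j hij
  by_cases hi : (i : ℕ) = 0
  · have hi' : i = 0 := Fin.ext hi
    subst hi'
    by_cases hj : j = 0
    · subst hj
      rw [apply_zero_zero_of_mem_oppositeCellRadical h3, Matrix.one_apply_eq]
    · have hjl : j ≠ Fin.last (n + 1) := by
        rintro rfl
        simp [lastBlockLabel, Fin.last] at hij
        exact absurd hij (by decide)
      rw [mul_apply_zero_of_mem_oppositeCellRadical h2 hr hj, mul_apply_zero_of_mem_oppositeCellRadical h1 he hj,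
        diag_mul_mul_inv_apply_zero, if_neg hjl, mul_one, inv_apply_zero_of_mem_oppositeCellRadical hr hj,
        he0 j hj hjl, Matrix.one_apply_ne (Ne.symm hj)]
      ring
  · exact apply_eq_one_of_mem_oppositeCellRadical h3 hi j

end Literature.NumberTheory.Automorphic.Zelevinsky1980

end
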